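import Literature.NumberTheory.Transcendental.DeRhamTheoremMultiplicative
import HarnessLib

/-!
# Crux `WeilSixfoldsSqrtMinus7` (stmt-HodgeConjecture-1260), line `hyperbolic-eightfold-descent` — stub S6 `stub_deRhamComparison`, CLOSED

Route `HeckePrymWeil`, single-problem summit `HodgeConjecture`. The registered named-fact stub S6 of
the line's skeleton (`Cruxes/WeilSixfoldsSqrtMinus7/Lines/hyperbolic_eightfold_descent.lean`, r1–r4):
de Rham's theorem as a natural, MULTIPLICATIVE, normalised comparison family
`exists_deRhamIsoFamily 𝓘(ℝ, E)` for every finite-dimensional complex model space `E` (F. Warner,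
GTM 94, Thm. 5.36 / Thm. 5.45). It was the one hypothesis left open by the line's wave 1 (consumed
by the Künneth-for-Hodge-types step S4, `stub_hodgeTypeExterior`, p88025, and by the cycle-1
composition `weilSixfoldsSqrtMinus7_of_hyperbolicEightfolds`, p92190). It is now the tree's THEOREM
`Literature.NumberTheory.Transcendental.exists_deRhamIsoFamily_holds`
(`Literature/NumberTheory/Transcendental/DeRhamTheoremMultiplicative`), so the stub closes by `exact`;
this file records that closure under the line's namespace (verbatim the registered signature).
-/

noncomputable section

-- single-problem summit (Problem = Summit): the mandated namespace repeats `HodgeConjecture`.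
set_option linter.dupNamespace false

namespace Summit.HodgeConjecture.HodgeConjecture.Theorems.WeilSixfoldsSqrtMinus7.HyperbolicEightfoldDescent

/-- **Stub S6 of line `hyperbolic-eightfold-descent`, closed**: de Rham's theorem in multiplicative
form, `exists_deRhamIsoFamily 𝓘(ℝ, E)` for every finite-dimensional complex normed space `E` — the
tree's `exists_deRhamIsoFamily_holds` (Warner Thm. 5.36 / 5.45: the natural integration comparison
family is multiplicative, wedge ↦ cup, and normalised). [cite: WarnerGTM94, Thm. 5.36 / Thm. 5.45] -/
theorem stub_deRhamComparison :
    ∀ (E : Type) [NormedAddCommGroup E] [NormedSpace ℂ E] [FiniteDimensional ℂ E],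
      Literature.NumberTheory.Transcendental.exists_deRhamIsoFamily (modelWithCornersSelf ℝ E) :=
  fun E _ _ _ => Literature.NumberTheory.Transcendental.exists_deRhamIsoFamily_holds E

end Summit.HodgeConjecture.HodgeConjecture.Theorems.WeilSixfoldsSqrtMinus7.HyperbolicEightfoldDescent

end
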